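import Mathlib

/-!
# Route GirthSidon — graph-theoretic engine for `ShortEvenCycle`

Helper lemmas (pure finite graph theory, stated over an arbitrary finite vertex type) for the
support item `ShortEvenCycle` of route `GirthSidon` (item stmt-ValiantsHypothesis-6540: a simple
graph on `N` vertices with `e` edges, `4^k N^{k+1} ≤ e^k`, contains an even cycle of length
`≤ 2k` — the weak Bondy–Simonovits bound).  The classical proof has three steps, each landed here
as a standalone lemma:

* `exists_coloring_card_edgeFinset_le_two_mul` — **max cut**: some `2`-colouring `c` makes at
  least half of the edges bichromatic (averaging over all `2^|V|` colourings; the bichromatic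
  subgraph is Mathlib's `G.between {v | c v} {v | c v}ᶜ`);
* `exists_core_of_lt_sum_card_neighborFinset_inter` — **min-degree core**: if a vertex set `S`
  spans more than `t·|S|` edges, some nonempty `S' ⊆ S` has all degrees into `S'` at least
  `t + 1` (delete low-degree vertices one at a time);
* `moore_layer_bound` — **even Moore bound**: in a graph whose closed walks are all even and
  which has no cycle of length `≤ 2k`, if every non-isolated vertex has degree `≥ δ` then the
  distance-`i` sphere around a non-isolated vertex has `≥ δ(δ-1)^{i-1}` vertices for `i ≤ k`
  (BFS layers grow by a factor `δ - 1`: unique parents via Mathlib's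
  `SimpleGraph.Walk.IsPath.exists_isCycle_length_le_add_of_ne`, no edges inside a layer by
  parity).

Sources: J. A. Bondy, M. Simonovits, *Cycles of even length in graphs*, JCTB 16 (1974) — only the
weak (Moore-bound) form is needed; Bondy–Murty, *Graph Theory* (2008), §2 (cores), Ex. 4.1.
No new definitions; everything is phrased with Mathlib's `SimpleGraph` API (`between`, `dist`,
`neighborFinset`, `Walk.IsCycle`).
-/

namespace Summit.ValiantsHypothesis.ValiantsHypothesis.Theorems.ShortEvenCycle

-- `Summit.ValiantsHypothesis.ValiantsHypothesis.…` is the tree's mandated single-conjunct layout (Sub = Summit).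
set_option linter.dupNamespace false

open Finset

section MaxCut

variable {V : Type*} [Fintype V] [DecidableEq V]

/-- For `x ≠ y`, exactly half of all maps `c : V → Bool` separate `x` from `y`:
`2 · #{c | c x ≠ c y} = 2 ^ |V|` (the involution `c ↦ update c x (!c x)` swaps the two halves).
[folklore] -/
theorem two_mul_card_filter_apply_ne {x y : V} (hxy : x ≠ y) :
    2 * #(univ.filter fun c : V → Bool => c x ≠ c y) = 2 ^ Fintype.card V := by
  have hAB : #(univ.filter fun c : V → Bool => c x ≠ c y)
      = #(univ.filter fun c : V → Bool => ¬ c x ≠ c y) := by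
    refine card_nbij' (fun c => Function.update c x (!c x)) (fun c => Function.update c x (!c x))
      ?_ ?_ ?_ ?_
    · intro c hc
      simp only [coe_filter, mem_univ, true_and, Set.mem_setOf_eq, ne_eq, Function.update_self,
        Function.update_of_ne (Ne.symm hxy)] at hc ⊢
      cases hx : c x <;> cases hy : c y <;> simp_all
    · intro c hc
      simp only [coe_filter, mem_univ, true_and, Set.mem_setOf_eq, ne_eq, Function.update_self,
        Function.update_of_ne (Ne.symm hxy)] at hc ⊢
      cases hx : c x <;> cases hy : c y <;> simp_all
    · intro c _
      simp
    · intro c _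
      simp
  have hsum := card_filter_add_card_filter_not (s := (univ : Finset (V → Bool)))
    (fun c : V → Bool => c x ≠ c y)
  rw [card_univ, Fintype.card_fun, Fintype.card_bool] at hsum
  omega

/-- **Max-cut averaging.** Every finite simple graph has a `2`-colouring `c : V → Bool` whose
bichromatic edges — the edges of `G.between {v | c v} {v | c v}ᶜ` — number at least half of all
edges. Proof: sum the number of bichromatic edges over all `2 ^ |V|` colourings; each edge is
bichromatic for exactly half of them (`two_mul_card_filter_apply_ne`). [folklore] -/
theorem exists_coloring_card_edgeFinset_le_two_mul (G : SimpleGraph V) [DecidableRel G.Adj] :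
    ∃ c : V → Bool, #G.edgeFinset ≤
      2 * #(G.between {v | c v = true} {v | c v = true}ᶜ).edgeFinset := by
  -- the bichromatic edge set of `c`, as a filter of `G.edgeFinset`
  have hfilter : ∀ c : V → Bool, (G.between {v | c v = true} {v | c v = true}ᶜ).edgeFinset
      = G.edgeFinset.filter fun e => e ∈ (G.between {v | c v = true} {v | c v = true}ᶜ).edgeSet := by
    intro c
    ext e
    simp only [SimpleGraph.mem_edgeFinset, mem_filter, iff_and_self]
    exact fun he => SimpleGraph.edgeSet_mono (SimpleGraph.between_le) he
  -- membership of an edge `s(x, y)` of `G` in the cut graph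
  have hmem : ∀ (c : V → Bool) (x y : V), G.Adj x y →
      (s(x, y) ∈ (G.between {v | c v = true} {v | c v = true}ᶜ).edgeSet ↔ c x ≠ c y) := by
    intro c x y hxy
    rw [SimpleGraph.mem_edgeSet, SimpleGraph.between_adj]
    simp only [hxy, true_and, Set.mem_setOf_eq, Set.mem_compl_iff, Bool.not_eq_true, ne_eq]
    cases c x <;> cases c y <;> simp
  -- double counting: `Σ_c 2·|E(H_c)| = Σ_{e ∈ E} 2·#{c | e bichromatic} = |E| · 2^|V|`
  have h1 : ∑ c : V → Bool, 2 * #(G.between {v | c v = true} {v | c v = true}ᶜ).edgeFinset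
      = 2 * ∑ c : V → Bool, ∑ e ∈ G.edgeFinset,
          (if e ∈ (G.between {v | c v = true} {v | c v = true}ᶜ).edgeSet then 1 else 0) := by
    rw [mul_sum]
    refine sum_congr rfl fun c _ => ?_
    rw [hfilter c, card_filter]
  have h2 : 2 * ∑ e ∈ G.edgeFinset, ∑ c : V → Bool,
        (if e ∈ (G.between {v | c v = true} {v | c v = true}ᶜ).edgeSet then 1 else 0)
      = ∑ e ∈ G.edgeFinset, 2 * #(univ.filter fun c : V → Bool =>
          e ∈ (G.between {v | c v = true} {v | c v = true}ᶜ).edgeSet) := by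
    rw [mul_sum]
    refine sum_congr rfl fun e _ => ?_
    rw [card_filter]
  have h3 : ∑ e ∈ G.edgeFinset, 2 * #(univ.filter fun c : V → Bool =>
        e ∈ (G.between {v | c v = true} {v | c v = true}ᶜ).edgeSet)
      = ∑ _e ∈ G.edgeFinset, 2 ^ Fintype.card V := by
    refine sum_congr rfl fun e he => ?_
    induction e using Sym2.ind with
    | h x y =>
      have hadj : G.Adj x y := by simpa using he
      have : (univ.filter fun c : V → Bool =>
          s(x, y) ∈ (G.between {v | c v = true} {v | c v = true}ᶜ).edgeSet)
          = univ.filter fun c : V → Bool => c x ≠ c y :=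
        filter_congr fun c _ => hmem c x y hadj
      rw [this, two_mul_card_filter_apply_ne hadj.ne]
  have h4 : ∑ _e ∈ G.edgeFinset, 2 ^ Fintype.card V = ∑ _c : V → Bool, #G.edgeFinset := by
    rw [sum_const, sum_const, card_univ, Fintype.card_fun, Fintype.card_bool, smul_eq_mul,
      smul_eq_mul, mul_comm]
  have hdouble : ∑ _c : V → Bool, #G.edgeFinset
      = ∑ c : V → Bool, 2 * #(G.between {v | c v = true} {v | c v = true}ᶜ).edgeFinset := by
    rw [h1, sum_comm, h2, h3, h4]
  obtain ⟨c, -, hc⟩ := exists_le_of_sum_le (univ_nonempty (α := V → Bool)) hdouble.le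
  exact ⟨c, hc⟩

end MaxCut

section Core

variable {V : Type*} [Fintype V] [DecidableEq V] (H : SimpleGraph V) [DecidableRel H.Adj]

/-- Removing a vertex `w ∈ S`: the sum over `S` of the degrees into `S` exceeds the same sum for
`S.erase w` by exactly twice the `S`-degree of `w` (ordered adjacent pairs through `w`).
[folklore] -/
theorem sum_card_neighborFinset_inter_erase_add {S : Finset V} {w : V} (hw : w ∈ S) :
    ∑ x ∈ S.erase w, #(H.neighborFinset x ∩ S.erase w) + 2 * #(H.neighborFinset w ∩ S)
      = ∑ x ∈ S, #(H.neighborFinset x ∩ S) := by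
  rw [← add_sum_erase S _ hw]
  have hx : ∀ x ∈ S.erase w, #(H.neighborFinset x ∩ S)
      = #(H.neighborFinset x ∩ S.erase w) + if H.Adj x w then 1 else 0 := by
    intro x _
    conv_lhs => rw [← insert_erase hw]
    by_cases hadj : H.Adj x w
    · rw [inter_insert_of_mem (by simpa using hadj), card_insert_of_notMem (by simp), if_pos hadj]
    · rw [inter_insert_of_notMem (by simpa using hadj), if_neg hadj, add_zero]
  rw [sum_congr rfl hx, sum_add_distrib, ← card_filter]
  have hfilt : (S.erase w).filter (fun x => H.Adj x w) = H.neighborFinset w ∩ S := by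
    ext x
    simp only [mem_filter, mem_erase, mem_inter, SimpleGraph.mem_neighborFinset]
    constructor
    · rintro ⟨⟨-, hxS⟩, hadj⟩
      exact ⟨hadj.symm, hxS⟩
    · rintro ⟨hadj, hxS⟩
      exact ⟨⟨hadj.ne.symm, hxS⟩, hadj.symm⟩
  rw [hfilt]
  ring

/-- **Min-degree core.** If `2·t·|S| < Σ_{x ∈ S} deg_S(x)` (more than `t·|S|` edges inside `S`),
then some nonempty `S' ⊆ S` has all degrees into `S'` at least `t + 1`: delete vertices of
`S`-degree `≤ t` one at a time; the edge surplus survives each deletion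
(`sum_card_neighborFinset_inter_erase_add`). Bondy–Murty 2008, §2 exercises. [folklore] -/
theorem exists_core_of_lt_sum_card_neighborFinset_inter (t : ℕ) (S : Finset V)
    (hS : 2 * t * #S < ∑ x ∈ S, #(H.neighborFinset x ∩ S)) :
    ∃ S' ⊆ S, S'.Nonempty ∧ ∀ w ∈ S', t + 1 ≤ #(H.neighborFinset w ∩ S') := by
  induction S using Finset.strongInduction with
  | H S ih =>
    by_cases hall : ∀ w ∈ S, t + 1 ≤ #(H.neighborFinset w ∩ S)
    · refine ⟨S, Subset.rfl, ?_, hall⟩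
      rcases S.eq_empty_or_nonempty with h | h
      · subst h
        simp at hS
      · exact h
    · push Not at hall
      obtain ⟨w, hw, hdeg⟩ := hall
      have h1 := sum_card_neighborFinset_inter_erase_add H hw
      have h2 : #(S.erase w) + 1 = #S := card_erase_add_one hw
      have h3 : 2 * t * #S = 2 * t * #(S.erase w) + 2 * t := by rw [← h2]; ring
      have hlt : 2 * t * #(S.erase w) < ∑ x ∈ S.erase w, #(H.neighborFinset x ∩ S.erase w) := by
        linarith
      obtain ⟨S', hS'sub, hS'ne, hS'deg⟩ := ih (S.erase w) (erase_ssubset hw) hlt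
      exact ⟨S', hS'sub.trans (erase_subset w S), hS'ne, hS'deg⟩

end Core

section Moore

variable {V : Type*} [Fintype V] [DecidableEq V] (H : SimpleGraph V) [DecidableRel H.Adj]

omit [Fintype V] [DecidableRel H.Adj] in
/-- **Unique parents in the BFS tree.** If `H` has no cycle of length `≤ 2k`, a vertex `x` at
distance `j + 1 ≤ k` from `v` has at most one neighbour at distance `j`: two such neighbours give
two distinct paths `v ⟶ x` of length `j + 1`, hence (Mathlib's
`SimpleGraph.Walk.IsPath.exists_isCycle_length_le_add_of_ne`) a cycle of length `≤ 2(j+1) ≤ 2k`.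
[folklore] -/
theorem eq_of_adj_of_dist_eq {k : ℕ}
    (hGirth : ∀ (u : V) (p : H.Walk u u), p.IsCycle → 2 * k < p.length)
    {v x w w' : V} {j : ℕ} (hj : j + 1 ≤ k) (hx : H.dist v x = j + 1)
    (hw : H.Adj w x) (hw' : H.Adj w' x) (hdw : H.dist v w = j) (hdw' : H.dist v w' = j)
    (hrw : H.Reachable v w) (hrw' : H.Reachable v w') : w = w' := by
  by_contra hne
  obtain ⟨p, hp, hpl⟩ := hrw.exists_path_of_dist
  obtain ⟨p', hp', hpl'⟩ := hrw'.exists_path_of_dist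
  have hxp : x ∉ p.support := by
    intro hxs
    have h1 := SimpleGraph.dist_le (p.takeUntil x hxs)
    have h2 := p.length_takeUntil_le_length hxs
    omega
  have hxp' : x ∉ p'.support := by
    intro hxs
    have h1 := SimpleGraph.dist_le (p'.takeUntil x hxs)
    have h2 := p'.length_takeUntil_le_length hxs
    omega
  have hP : (p.concat hw).IsPath := hp.concat hxp hw
  have hP' : (p'.concat hw').IsPath := hp'.concat hxp' hw'
  have hne' : p.concat hw ≠ p'.concat hw' := by
    intro h
    obtain ⟨hvv, -⟩ := SimpleGraph.Walk.concat_inj h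
    exact hne hvv
  obtain ⟨u, -, -, c, hc, hcl⟩ := hP.exists_isCycle_length_le_add_of_ne hP' hne'
  have := hGirth u c hc
  rw [SimpleGraph.Walk.length_concat, SimpleGraph.Walk.length_concat] at hcl
  omega

/-- **Even Moore bound (layer growth).** Let `H` be a finite graph in which every closed walk has
even length and no cycle has length `≤ 2k`, and suppose every non-isolated vertex has degree
`≥ δ`. If `v` is non-isolated then, for `1 ≤ i ≤ k`, at least `δ (δ - 1)^(i-1)` vertices lie at
distance exactly `i` from `v`: a vertex at distance `i` has no neighbour at distance `i` (parity),
at most one at distance `i - 1` (`eq_of_adj_of_dist_eq`), hence `≥ δ - 1` at distance `i + 1`,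
and these children sets are pairwise disjoint (`eq_of_adj_of_dist_eq` again). [folklore] -/
theorem moore_layer_bound {k δ : ℕ}
    (hEven : ∀ (u : V) (p : H.Walk u u), Even p.length)
    (hGirth : ∀ (u : V) (p : H.Walk u u), p.IsCycle → 2 * k < p.length)
    (hδ : ∀ w, 0 < H.degree w → δ ≤ H.degree w) {v : V} (hv : 0 < H.degree v) :
    ∀ i, 1 ≤ i → i ≤ k → δ * (δ - 1) ^ (i - 1) ≤ #(univ.filter fun w => H.dist v w = i) := by
  -- membership in a layer `i ≥ 1` gives reachability
  have reach : ∀ {w : V} {i : ℕ}, H.dist v w = i → 1 ≤ i → H.Reachable v w := fun h hi =>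
    SimpleGraph.Reachable.of_dist_ne_zero (by omega)
  -- no edge inside a layer (closed walks are even)
  have noflat : ∀ {w x : V}, H.Reachable v w → H.Adj w x → H.dist v x ≠ H.dist v w := by
    intro w x hr hadj heq
    obtain ⟨p, hp⟩ := hr.exists_walk_length_eq_dist
    obtain ⟨q, hq⟩ := (hr.trans hadj.reachable).exists_walk_length_eq_dist
    have := hEven v ((p.concat hadj).append q.reverse)
    rw [SimpleGraph.Walk.length_append, SimpleGraph.Walk.length_concat,
      SimpleGraph.Walk.length_reverse, hp, hq, heq, Nat.even_iff] at this
    omega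
  intro i
  induction i with
  | zero => intro h; omega
  | succ i ih =>
    intro _ hik
    rcases Nat.eq_zero_or_pos i with rfl | hi
    · -- layer 1 = neighbours of v
      have hL1 : (univ.filter fun w => H.dist v w = 0 + 1) = H.neighborFinset v := by
        ext w
        simp [SimpleGraph.dist_eq_one_iff_adj]
      rw [hL1, SimpleGraph.card_neighborFinset_eq_degree]
      simpa using hδ v hv
    · have hIH := ih hi (by omega)
      set L := univ.filter (fun w => H.dist v w = i) with hL
      set L' := univ.filter (fun w => H.dist v w = i + 1) with hL'
      -- every vertex of layer `i` has `≥ δ - 1` children in layer `i + 1`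
      have hchild : ∀ w ∈ L, δ - 1 ≤ #(H.neighborFinset w ∩ L') := by
        intro w hw
        have hdw : H.dist v w = i := by simpa [L] using hw
        have hrw : H.Reachable v w := reach hdw hi
        have hdeg : δ ≤ H.degree w := by
          refine hδ w ?_
          have hne : w ≠ v := by
            rintro rfl
            rw [SimpleGraph.dist_self] at hdw
            omega
          obtain ⟨q⟩ := hrw.symm
          have hq : ¬ q.Nil := fun hn => hne hn.eq
          rw [← SimpleGraph.card_neighborFinset_eq_degree, Finset.card_pos]
          exact ⟨q.snd, by simpa using q.adj_snd hq⟩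
        have hsplit : H.neighborFinset w ⊆
            (H.neighborFinset w ∩ univ.filter (fun x => H.dist v x = i - 1)) ∪
              (H.neighborFinset w ∩ L') := by
          intro x hx
          have hadj : H.Adj w x := by simpa using hx
          have h3 := hadj.diff_dist_adj (u := v)
          have hnf := noflat hrw hadj
          simp only [mem_union, mem_inter, hx, true_and, mem_filter, mem_univ, L']
          omega
        have hpar : #(H.neighborFinset w ∩ univ.filter (fun x => H.dist v x = i - 1)) ≤ 1 := by
          rw [Finset.card_le_one]
          intro a ha b hb
          simp only [mem_inter, SimpleGraph.mem_neighborFinset, mem_filter, mem_univ,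
            true_and] at ha hb
          exact eq_of_adj_of_dist_eq H hGirth (j := i - 1) (x := w) (by omega) (by omega)
            ha.1.symm hb.1.symm ha.2 hb.2 (hrw.trans ha.1.reachable) (hrw.trans hb.1.reachable)
        have h1 := card_le_card hsplit
        have h2 := card_union_le
          (H.neighborFinset w ∩ univ.filter (fun x => H.dist v x = i - 1))
          (H.neighborFinset w ∩ L')
        rw [SimpleGraph.card_neighborFinset_eq_degree] at h1
        omega
      -- children sets of distinct parents are disjoint
      have hdisj : (L : Set V).PairwiseDisjoint (fun w => H.neighborFinset w ∩ L') := by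
        intro a ha b hb hab
        rw [Function.onFun, Finset.disjoint_left]
        intro x hxa hxb
        simp only [mem_inter, SimpleGraph.mem_neighborFinset, mem_filter, mem_univ, true_and,
          L'] at hxa hxb
        have hda : H.dist v a = i := by simpa [L] using ha
        have hdb : H.dist v b = i := by simpa [L] using hb
        exact hab (eq_of_adj_of_dist_eq H hGirth (j := i) hik hxa.2 hxa.1 hxb.1 hda hdb
          (reach hda hi) (reach hdb hi))
      have hsub : L.biUnion (fun w => H.neighborFinset w ∩ L') ⊆ L' := by
        intro x hx
        simp only [mem_biUnion, mem_inter] at hx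
        obtain ⟨w, -, -, h⟩ := hx
        exact h
      calc δ * (δ - 1) ^ (i + 1 - 1) = (δ * (δ - 1) ^ (i - 1)) * (δ - 1) := by
            rw [mul_assoc, ← pow_succ]
            congr 2
            omega
        _ ≤ #L * (δ - 1) := Nat.mul_le_mul_right _ hIH
        _ = ∑ _w ∈ L, (δ - 1) := by rw [sum_const, smul_eq_mul]
        _ ≤ ∑ w ∈ L, #(H.neighborFinset w ∩ L') := sum_le_sum hchild
        _ = #(L.biUnion fun w => H.neighborFinset w ∩ L') := (card_biUnion hdisj).symm
        _ ≤ #L' := card_le_card hsub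

end Moore

end Summit.ValiantsHypothesis.ValiantsHypothesis.Theorems.ShortEvenCycle
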